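import Literature.Barriers.CriticalPhenomena.LaceExpansionIsingAboveFourBubbleBound
import Literature.Probability.LatticeModels.AizenmanGrahamInequalityProofs
import HarnessLib

/-!
# Aizenman's bubble bound for the nearest-neighbour model: `NNIsing.bubble_susceptibility_upper`
# from the Aizenman–Graham inequality

Barrier catalogue `Literature/Barriers/CriticalPhenomena/` (D-0021), proof file serving the
discharge of the named fact `NNIsing.bubble_susceptibility_upper` of
`LaceExpansionIsingAboveFourReduction.lean` (bubble condition ⇒ `γ ≤ 1` for the nearest-neighbour
Ising model on `ℤ^d`, `d ≥ 2`: `B(β_c) < ∞ ⇒ χ(β) ≤ C (β_c - β)⁻¹` near `β_c`; Aizenman 1982,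
Aizenman–Graham 1983, as quoted by Sakai 2007, §1.1). This file PROVES

* `NNIsing.bubble_susceptibility_upper_of_aizenmanGraham`:
  `(∀ d n β, aizenmanGraham_inequality (zdGraph d) (box d n) β) → NNIsing.bubble_susceptibility_upper`,

the nearest-neighbour twin of `SpreadOutIsing.bubble_susceptibility_upper_of_aizenmanGraham`
(`LaceExpansionIsingAboveFourBubbleBound.lean`), by the same argument — the finite-volume
Aizenman–Graham differential inequality of that file (its Part A, valid on any locally finite
graph: `drivingTerm_sub_le_deriv_volumeSusceptibility`), integrated in the boxes `Λ_n` of `ℤ^d`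
with the mean value theorem, the volume limit `S_0^{Λ_n}(β) ↑ χ(β)`, and the elementary
comparison lemma `le_inv_of_increment_ge` — following Tasaki–Hara 2015, Thm. 10.13 along
(10.63)–(10.69), for the tree's objects of the nearest-neighbour model (`zdGraph d`,
`susceptibility d β = Σ_x ⟨σ₀σ_x⟩^∅_{β,0}`, `twoPointFree`, `criticalBeta d`,
`NNIsing.bubbleDiagram d β = Σ_x ⟨σ₀σ_x⟩²`).

## The steps (free boundary condition throughout)

1. `b_{Λ_n}(z) ≤ 2d Σ_u ⟨σ_uσ_z⟩²_{Λ_n} ≤ 2d B(β) ≤ 2d B(β_c) =: B₂` for `0 ≤ β ≤ β_c`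
   (`⟨σ_uσ_z⟩_{Λ_n} ≤ ⟨σ₀σ_{z-u}⟩^∅_β`, translation covariance and GKS; `edgeBubble_box_le`).
2. `(β₂-β₁)(M_{Λ_n}(β₁) - B₂ S_0^{Λ_n}(β₂)) ≤ (1+B₂)(S_0^{Λ_n}(β₂) - S_0^{Λ_n}(β₁))` for
   `0 ≤ β₁ ≤ β₂ ≤ β_c` (`boxSusc_increment_ge`).
3. `M_{Λ_n}(β) ≥ (S_0^{Λ_m}(β))²` for `n ≥ 2m + 1` (every site `u ∈ Λ_m` has the neighbour
   `u + e₀ ∈ Λ_n`, and `S_{u+e₀}^{Λ_n} ≥ S_0^{Λ_m}` by translation; `sq_le_drivingTerm`), and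
   `S_0^{Λ_n}(β) → χ(β)` for `χ(β) < ∞` (`tendsto_boxSusc`) give
   `(β₂-β₁)(χ_{β₁}² - B₂χ_{β₂}) ≤ (1+B₂)(χ_{β₂} - χ_{β₁})` below `β_c` (`susceptibility_increment_ge`).
4. `le_inv_of_increment_ge` with `J = 1`: `χ(β) ≤ 2(1+B₂)(β_c - β)⁻¹` on `[β₀, β_c)` for any
   `β₀ < β_c` with `χ(β₀) ≥ 2B₂` (exists since `χ ↑ ∞`, `susceptibility_unbounded_below_criticalBeta`).

With the discharge `aizenmanGraham_inequality_holds` (`AizenmanGrahamInequalityProofs.lean`) of the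
Aizenman–Graham inequality the hypothesis is a theorem and `bubble_susceptibility_upper_holds`
follows in one line (last section).

## References

* H. Tasaki, T. Hara, 相転移と臨界現象の数理, Kyoritsu Shuppan 2015, Ch. 10 §3.3 (Thm. 10.13,
  (10.63)–(10.69)), App. A Thm. A.18 (A.125) [TasakiHara2015].
* A. Sakai, Comm. Math. Phys. 272 (2007) 283–344, §1.1 [Sakai2007].
* M. Aizenman, R. Graham, Nucl. Phys. B 225 (1983) 261–288 [AizenmanGraham1983];
  M. Aizenman, Comm. Math. Phys. 86 (1982) 1–48 [Aizenman1982].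
* S. Friedli, Y. Velenik, *Statistical Mechanics of Lattice Systems*, CUP 2017, Thm. 3.20,
  Exercises 3.12–3.13, 3.16 [FriedliVelenik2017].
-/

noncomputable section

namespace Literature.Barriers.CriticalPhenomena.NNIsing

open MeasureTheory Filter Topology Finset Literature.Probability.LatticeModels Literature.Probability.Percolation
open Literature.Barriers.CriticalPhenomena.SpreadOutIsing (edgeBubble drivingTerm
  drivingTerm_sub_le_deriv_volumeSusceptibility edgeBubble_le_degree_mul_sum_sq le_inv_of_increment_ge
  deriv_volumeSusceptibility_eq_sum_pairCov)
open scoped ENNReal BigOperators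

variable {d : ℕ}

/-! ### The bubble constant and the edge bubble of a box -/

/-- **The constant `B₂ = 2d · B(β_c)`** — the uniform bound on the edge bubble of every box of
`ℤ^d` at every `β ≤ β_c` (Tasaki–Hara, Lemma 10.11 / eq. (10.67):
`Σ_{{u,v}} ⟨σ_oσ_u⟩⟨σ_oσ_v⟩ ≤ d B_L(β)`, counted here over ordered pairs) — is nonnegative. It is
written out as `2d · B(β_c).toReal` throughout this file. [cite: TasakiHara2015, Ch. 10, eq. (10.67)] -/
theorem nnBubbleBoundConst_nonneg (d : ℕ) : 0 ≤ (2 * d : ℝ) * (bubbleDiagram d (criticalBeta d)).toReal :=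
  mul_nonneg (by positivity) ENNReal.toReal_nonneg

/-- **The bubble diagram is nondecreasing in `β ≥ 0`** (termwise, Griffiths' monotonicity of the
free two-point function in `β`). [cite: FriedliVelenik2017, Exercise 3.9 with Thm. 3.20] -/
theorem bubbleDiagram_mono : MonotoneOn (bubbleDiagram d) (Set.Ici 0) := by
  intro β hβ β' _ hle
  refine ENNReal.tsum_le_tsum fun x => ?_
  gcongr
  exact twoPointFree_mono_beta isingCorr_free_mono_beta_holds hasBoxLimit_isingCorr_free_holds hβ hle x

/-- **The on-site squares of a box are below the bubble diagram**: for `β ≥ 0`, `z ∈ Λ_n`,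
`Σ_{u ∈ Λ_n} ⟨σ_uσ_z⟩²_{Λ_n;β} ≤ B(β)` (termwise `⟨σ_uσ_z⟩_{Λ_n} ≤ ⟨σ₀σ_{z-u}⟩^∅_β` by translation
covariance and GKS volume monotonicity, and a finite partial sum of the reindexed series is below
it). [cite: TasakiHara2015, Ch. 10, eq. (10.67)] -/
theorem sum_sq_isingTwoPoint_le_bubbleDiagram {β : ℝ} (hβ : 0 ≤ β) {n : ℕ} {z : Site d}
    (hz : z ∈ box d n) (hfin : bubbleDiagram d β < ∞) :
    ∑ u ∈ box d n, isingTwoPoint (zdGraph d) (box d n) β 0 .free u z ^ 2 ≤ (bubbleDiagram d β).toReal := by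
  have hlim : hasBoxLimit_isingCorr_free d := hasBoxLimit_isingCorr_free_holds
  have hgks : ∀ {Λ A : Finset (Site d)} {β h : ℝ} {bc : BoundaryCondition (Site d)},
      gks_one (zdGraph d) (Λ := Λ) (A := A) (β := β) (h := h) (bc := bc) :=
    Literature.Probability.LatticeModels.GKSInequalities.gks_one_holds (zdGraph d)
  have hG0 : ∀ y, 0 ≤ twoPointFree d β y := fun y => twoPointFree_nonneg hlim hgks hβ y
  have hterm : ∀ u ∈ box d n, isingTwoPoint (zdGraph d) (box d n) β 0 .free u z ^ 2 ≤
      twoPointFree d β (z - u) ^ 2 := fun u hu =>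
    pow_le_pow_left₀ (SpreadOutIsing.isingTwoPoint_free_nonneg _ hβ hu hz)
      (isingTwoPoint_free_le_twoPointFree_sub isingCorr_free_mono_volume_holds hlim
        isingTwoPoint_free_translate_holds hβ hu hz) 2
  refine (Finset.sum_le_sum hterm).trans ?_
  have h2 : ENNReal.ofReal (∑ u ∈ box d n, twoPointFree d β (z - u) ^ 2) ≤ bubbleDiagram d β := by
    rw [ENNReal.ofReal_sum_of_nonneg fun u _ => sq_nonneg _]
    calc ∑ u ∈ box d n, ENNReal.ofReal (twoPointFree d β (z - u) ^ 2)
        = ∑ u ∈ box d n, ENNReal.ofReal (twoPointFree d β (z - u)) ^ 2 :=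
          Finset.sum_congr rfl fun u _ => by rw [ENNReal.ofReal_pow (hG0 _)]
      _ ≤ ∑' u : Site d, ENNReal.ofReal (twoPointFree d β (z - u)) ^ 2 := ENNReal.sum_le_tsum _
      _ = ∑' x : Site d, ENNReal.ofReal (twoPointFree d β x) ^ 2 :=
          (Equiv.subLeft z).tsum_eq (fun x => ENNReal.ofReal (twoPointFree d β x) ^ 2)
      _ = bubbleDiagram d β := rfl
  exact (ENNReal.ofReal_le_iff_le_toReal hfin.ne).1 h2

/-- **The edge bubble of a box is at most `B₂`** for `0 ≤ β ≤ β_c` under the bubble condition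
(`b_Λ(z) ≤ 2d Σ_u ⟨σ_uσ_z⟩² ≤ 2d B(β) ≤ 2d B(β_c)`; Tasaki–Hara, Lemma 10.11 with (10.67)).
[cite: TasakiHara2015, Ch. 10, eq. (10.67)] -/
theorem edgeBubble_box_le {β : ℝ} (hβ : 0 ≤ β) (hβc : β ≤ criticalBeta d) (hB : BubbleCondition d)
    {n : ℕ} {z : Site d} (hz : z ∈ box d n) :
    edgeBubble (zdGraph d) (box d n) β z ≤ ((2 * d : ℝ) * (bubbleDiagram d (criticalBeta d)).toReal) := by
  have hmono : bubbleDiagram d β ≤ bubbleDiagram d (criticalBeta d) :=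
    bubbleDiagram_mono hβ (hβ.trans hβc) hβc
  have hfin : bubbleDiagram d β < ∞ := lt_of_le_of_lt hmono hB
  calc edgeBubble (zdGraph d) (box d n) β z
      ≤ ((2 * d : ℕ) : ℝ) * ∑ u ∈ box d n, isingTwoPoint (zdGraph d) (box d n) β 0 .free u z ^ 2 :=
        edgeBubble_le_degree_mul_sum_sq _ card_neighborFinset_zdGraph_le z
    _ ≤ ((2 * d : ℕ) : ℝ) * (bubbleDiagram d β).toReal :=
        mul_le_mul_of_nonneg_left (sum_sq_isingTwoPoint_le_bubbleDiagram hβ hz hfin) (Nat.cast_nonneg _)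
    _ ≤ ((2 * d : ℝ) * (bubbleDiagram d (criticalBeta d)).toReal) := by
        push_cast
        exact mul_le_mul_of_nonneg_left (ENNReal.toReal_mono hB.ne hmono) (by positivity)

/-! ### The box susceptibilities `S_0^{Λ_n}(β)` -/

/-- `S_0^{Λ_n}(β)` is nondecreasing in the box for `β ≥ 0` (GKS volume monotonicity and
nonnegativity). [cite: FriedliVelenik2017, Exercise 3.12] -/
theorem boxSusc_mono_volume {β : ℝ} (hβ : 0 ≤ β) : Monotone fun n => volumeSusceptibility (zdGraph d) (box d n) β 0 := by
  intro m n hmn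
  calc volumeSusceptibility (zdGraph d) (box d m) β 0 = ∑ y ∈ box d m, isingTwoPoint (zdGraph d) (box d m) β 0 .free 0 y := rfl
    _ ≤ ∑ y ∈ box d m, isingTwoPoint (zdGraph d) (box d n) β 0 .free 0 y :=
        Finset.sum_le_sum fun y hy => SpreadOutIsing.isingTwoPoint_free_le_of_subset _ hβ
          (zero_mem_box d m) hy (box_mono d hmn)
    _ ≤ ∑ y ∈ box d n, isingTwoPoint (zdGraph d) (box d n) β 0 .free 0 y :=
        Finset.sum_le_sum_of_subset_of_nonneg (box_mono d hmn) fun y hy _ =>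
          SpreadOutIsing.isingTwoPoint_free_nonneg _ hβ (zero_mem_box d n) hy

/-- **`S_0^{Λ_n}(β) → χ(β)`** for `β ≥ 0` with `χ(β) < ∞` (monotone convergence of the
finite-volume two-point functions; `χ(β)` is the supremum of the box susceptibilities).
[cite: FriedliVelenik2017, Exercise 3.16 and §3.7.4] -/
theorem tendsto_boxSusc {β : ℝ} (hβ : 0 ≤ β) (hfin : susceptibility d β < ∞) :
    Tendsto (fun n => volumeSusceptibility (zdGraph d) (box d n) β 0) atTop (𝓝 (susceptibility d β).toReal) := by
  have h1 : Tendsto (fun n : ℕ => ENNReal.ofReal (volumeSusceptibility (zdGraph d) (box d n) β 0)) atTop (𝓝 (susceptibility d β)) := by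
    rw [tendsto_order]
    refine ⟨fun r hr => eventually_lt_volumeSusceptibility_box hβ hr, fun r hr => ?_⟩
    exact Filter.Eventually.of_forall fun n =>
      lt_of_le_of_lt (ofReal_volumeSusceptibility_le_susceptibility hβ (zero_mem_box d n)) hr
  have h2 := (ENNReal.tendsto_toReal hfin.ne).comp h1
  refine h2.congr fun n => ?_
  simp only [Function.comp_apply]
  exact ENNReal.toReal_ofReal (zero_le_one.trans (one_le_volumeSusceptibility hβ (zero_mem_box d n)))

/-! ### The differential inequality in the boxes and its integrated form -/

/-- **The finite-volume Aizenman–Graham inequality for boxes of `ℤ^d`**: for `0 ≤ β ≤ β_c` under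
the bubble condition, `M_{Λ_n}(0) - B₂ S_0^{Λ_n} ≤ (1 + B₂) dS_0^{Λ_n}/dβ` (from the general
finite-volume inequality with `b ≤ B₂` and `tanh β ≤ 1`). [cite: TasakiHara2015, Ch. 10, eqs. (10.64)–(10.68)] -/
theorem drivingTerm_box_sub_le (hAG : ∀ (n : ℕ) (β : ℝ), aizenmanGraham_inequality (zdGraph d) (box d n) β)
    {β : ℝ} (hβ : 0 ≤ β) (hβc : β ≤ criticalBeta d) (hB : BubbleCondition d) (n : ℕ) :
    drivingTerm (zdGraph d) (box d n) β 0 - ((2 * d : ℝ) * (bubbleDiagram d (criticalBeta d)).toReal) * volumeSusceptibility (zdGraph d) (box d n) β 0 ≤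
      (1 + ((2 * d : ℝ) * (bubbleDiagram d (criticalBeta d)).toReal)) * deriv (fun β => volumeSusceptibility (zdGraph d) (box d n) β 0) β := by
  have h := drivingTerm_sub_le_deriv_volumeSusceptibility (zdGraph d) (hAG n β) hβ
    (zero_mem_box d n) (fun z hz => edgeBubble_box_le hβ hβc hB hz)
  have hderiv : 0 ≤ deriv (fun β => volumeSusceptibility (zdGraph d) (box d n) β 0) β := by
    show 0 ≤ deriv (fun β => volumeSusceptibility (zdGraph d) (box d n) β 0) β
    rw [deriv_volumeSusceptibility_eq_sum_pairCov]
    refine mul_nonneg (by norm_num) (Finset.sum_nonneg fun y hy => Finset.sum_nonneg fun u hu =>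
      Finset.sum_nonneg fun v hv => ?_)
    exact SpreadOutIsing.isingPairCov_free_nonneg _ hβ hu (Finset.mem_filter.1 hv).1 (zero_mem_box d n) hy
  have hτ : Real.tanh β ≤ 1 := (Real.tanh_lt_one β).le
  have hB0 := nnBubbleBoundConst_nonneg d
  calc drivingTerm (zdGraph d) (box d n) β 0 - ((2 * d : ℝ) * (bubbleDiagram d (criticalBeta d)).toReal) * volumeSusceptibility (zdGraph d) (box d n) β 0
      ≤ (1 + Real.tanh β * ((2 * d : ℝ) * (bubbleDiagram d (criticalBeta d)).toReal)) * deriv (fun β => volumeSusceptibility (zdGraph d) (box d n) β 0) β := h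
    _ ≤ (1 + ((2 * d : ℝ) * (bubbleDiagram d (criticalBeta d)).toReal)) * deriv (fun β => volumeSusceptibility (zdGraph d) (box d n) β 0) β := by
        refine mul_le_mul_of_nonneg_right ?_ hderiv
        nlinarith

/-- The driving term of a box is nondecreasing in `β ≥ 0` (products of nonnegative
nondecreasing functions, GKS). [cite: FriedliVelenik2017, Exercise 3.13] -/
theorem drivingTerm_box_mono (n : ℕ) :
    MonotoneOn (fun β => drivingTerm (zdGraph d) (box d n) β 0) (Set.Ici 0) := by
  intro β hβ β' hβ' hle
  refine Finset.sum_le_sum fun u hu => Finset.sum_le_sum fun v hv => ?_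
  have hv' : v ∈ box d n := (Finset.mem_filter.1 hv).1
  refine mul_le_mul (SpreadOutIsing.isingTwoPoint_free_mono_beta (zdGraph d) (zero_mem_box d n) hu hβ hβ' hle)
    ?_ ?_ (SpreadOutIsing.isingTwoPoint_free_nonneg _ hβ' (zero_mem_box d n) hu)
  · exact Finset.sum_le_sum fun y hy =>
      SpreadOutIsing.isingTwoPoint_free_mono_beta (zdGraph d) hv' hy hβ hβ' hle
  · exact Finset.sum_nonneg fun y hy => SpreadOutIsing.isingTwoPoint_free_nonneg _ hβ hv' hy

/-- **Integrated form (mean value theorem in finite volume)**: for `0 ≤ β₁ ≤ β₂ ≤ β_c` under the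
bubble condition,
`(β₂ - β₁)(M_{Λ_n}(β₁) - B₂ S_0^{Λ_n}(β₂)) ≤ (1 + B₂)(S_0^{Λ_n}(β₂) - S_0^{Λ_n}(β₁))`.
[cite: TasakiHara2015, Ch. 10, Thm. 10.13 (integration of (10.69))] -/
theorem boxSusc_increment_ge (hAG : ∀ (n : ℕ) (β : ℝ), aizenmanGraham_inequality (zdGraph d) (box d n) β)
    (hB : BubbleCondition d) {β₁ β₂ : ℝ} (h0 : 0 ≤ β₁) (h12 : β₁ ≤ β₂) (h2c : β₂ ≤ criticalBeta d)
    (n : ℕ) :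
    (β₂ - β₁) * (drivingTerm (zdGraph d) (box d n) β₁ 0 - ((2 * d : ℝ) * (bubbleDiagram d (criticalBeta d)).toReal) * volumeSusceptibility (zdGraph d) (box d n) β₂ 0) ≤
      (1 + ((2 * d : ℝ) * (bubbleDiagram d (criticalBeta d)).toReal)) * (volumeSusceptibility (zdGraph d) (box d n) β₂ 0 - volumeSusceptibility (zdGraph d) (box d n) β₁ 0) := by
  set A := 1 + ((2 * d : ℝ) * (bubbleDiagram d (criticalBeta d)).toReal) with hA
  set f : ℝ → ℝ := fun β => A * volumeSusceptibility (zdGraph d) (box d n) β 0 with hf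
  set Cst := drivingTerm (zdGraph d) (box d n) β₁ 0 - ((2 * d : ℝ) * (bubbleDiagram d (criticalBeta d)).toReal) * volumeSusceptibility (zdGraph d) (box d n) β₂ 0 with hCst
  have hdiff : ∀ β, HasDerivAt (fun β => volumeSusceptibility (zdGraph d) (box d n) β 0) (deriv (fun β => volumeSusceptibility (zdGraph d) (box d n) β 0) β) β := fun β =>
    (hasDerivAt_volumeSusceptibility (zdGraph d) (box d n) β 0).differentiableAt.hasDerivAt
  have hfd : ∀ β, HasDerivAt f (A * deriv (fun β => volumeSusceptibility (zdGraph d) (box d n) β 0) β) β := fun β => (hdiff β).const_mul A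
  have hcont : ContinuousOn f (Set.Icc β₁ β₂) := fun β _ => (hfd β).continuousAt.continuousWithinAt
  have hdiff' : DifferentiableOn ℝ f (interior (Set.Icc β₁ β₂)) := fun β _ =>
    (hfd β).differentiableAt.differentiableWithinAt
  have hbound : ∀ β ∈ interior (Set.Icc β₁ β₂), Cst ≤ deriv f β := by
    intro β hβ
    rw [interior_Icc] at hβ
    have hβ0 : 0 ≤ β := h0.trans hβ.1.le
    rw [(hfd β).deriv]
    have h1 := drivingTerm_box_sub_le hAG hβ0 (hβ.2.le.trans h2c) hB n
    have h2 : drivingTerm (zdGraph d) (box d n) β₁ 0 ≤ drivingTerm (zdGraph d) (box d n) β 0 :=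
      drivingTerm_box_mono n h0 hβ0 hβ.1.le
    have h3 : volumeSusceptibility (zdGraph d) (box d n) β 0 ≤ volumeSusceptibility (zdGraph d) (box d n) β₂ 0 :=
      monotoneOn_volumeSusceptibility (zero_mem_box d n) hβ0 (hβ0.trans hβ.2.le) hβ.2.le
    have h4 := mul_le_mul_of_nonneg_left h3 (nnBubbleBoundConst_nonneg d)
    simp only [hCst]
    linarith
  have := (convex_Icc β₁ β₂).mul_sub_le_image_sub_of_le_deriv hcont hdiff' hbound β₁
    (Set.left_mem_Icc.2 h12) β₂ (Set.right_mem_Icc.2 h12) h12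
  simp only [hf] at this
  calc (β₂ - β₁) * Cst = Cst * (β₂ - β₁) := mul_comm _ _
    _ ≤ A * volumeSusceptibility (zdGraph d) (box d n) β₂ 0 - A * volumeSusceptibility (zdGraph d) (box d n) β₁ 0 := this
    _ = A * (volumeSusceptibility (zdGraph d) (box d n) β₂ 0 - volumeSusceptibility (zdGraph d) (box d n) β₁ 0) := by ring

/-! ### The volume limit -/

/-- **A translated box inside a big box bounds `S_v` from below**: for `β ≥ 0` and
`‖v‖_∞ + m ≤ n`, `S_0^{Λ_m}(β) ≤ S_v^{Λ_n}(β)` (`⟨σ₀σ_b⟩_{Λ_m} ≤ ⟨σ_vσ_{v+b}⟩_{Λ_n}` by translation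
covariance and GKS volume monotonicity, `Λ_m + v ⊆ Λ_n`; then drop the other terms).
[cite: FriedliVelenik2017, proof of Thm. 3.17 (p. 114) and Exercise 3.12] -/
theorem boxSusc_le_volumeSusceptibility {β : ℝ} (hβ : 0 ≤ β) {m n : ℕ} {v : Site d}
    (hv : Site.supNorm v + m ≤ n) :
    volumeSusceptibility (zdGraph d) (box d m) β 0 ≤ volumeSusceptibility (zdGraph d) (box d n) β v := by
  have hsub : (box d m).image (· + v) ⊆ box d n := by
    intro y hy
    obtain ⟨b, hb, rfl⟩ := Finset.mem_image.1 hy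
    rw [mem_box_iff_supNorm_le] at hb ⊢
    have := Site.supNorm_add_le b v
    omega
  have hvn : v ∈ box d n := by
    have : (0 : Site d) + v ∈ (box d m).image (· + v) := Finset.mem_image.2 ⟨0, zero_mem_box d m, rfl⟩
    rw [zero_add] at this
    exact hsub this
  unfold volumeSusceptibility
  calc volumeSusceptibility (zdGraph d) (box d m) β 0 = ∑ b ∈ box d m, isingTwoPoint (zdGraph d) (box d m) β 0 .free 0 b := rfl
    _ ≤ ∑ b ∈ box d m, isingTwoPoint (zdGraph d) (box d n) β 0 .free v (v + b) :=
        Finset.sum_le_sum fun b hb => isingTwoPoint_free_le_translate isingCorr_free_mono_volume_holds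
          isingTwoPoint_free_translate_holds hβ hsub (zero_mem_box d m) hb
    _ = ∑ x ∈ (box d m).image (v + ·), isingTwoPoint (zdGraph d) (box d n) β 0 .free v x := by
        rw [Finset.sum_image fun b _ b' _ h => add_left_cancel h]
    _ ≤ ∑ x ∈ box d n, isingTwoPoint (zdGraph d) (box d n) β 0 .free v x := by
        refine Finset.sum_le_sum_of_subset_of_nonneg (fun x hx => ?_) fun x hx _ =>
          SpreadOutIsing.isingTwoPoint_free_nonneg _ hβ hvn hx
        obtain ⟨b, hb, rfl⟩ := Finset.mem_image.1 hx
        rw [add_comm]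
        exact hsub (Finset.mem_image.2 ⟨b, hb, rfl⟩)

/-- **Lower bound on the driving term by the square of a smaller box susceptibility**: for `d ≥ 1`,
`β ≥ 0` and `n ≥ 2m + 1`, `M_{Λ_n}(0) ≥ S_0^{Λ_m}(β)²` (keep, for each `u ∈ Λ_m`, the single
neighbour `v = u + e₀ ∈ Λ_n`; `⟨σ₀σ_u⟩_{Λ_n} ≥ ⟨σ₀σ_u⟩_{Λ_m}` and `S_v^{Λ_n} ≥ S_0^{Λ_m}` since
`‖v‖_∞ ≤ m + 1`). [cite: TasakiHara2015, Ch. 10, eq. (10.64) (the term 2d(χ/β)²)] -/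
theorem sq_le_drivingTerm (hd : 1 ≤ d) {β : ℝ} (hβ : 0 ≤ β) {m n : ℕ} (hmn : 2 * m + 1 ≤ n) :
    volumeSusceptibility (zdGraph d) (box d m) β 0 ^ 2 ≤ drivingTerm (zdGraph d) (box d n) β 0 := by
  have hmn' : m ≤ n := by omega
  have hS0 : 0 ≤ volumeSusceptibility (zdGraph d) (box d m) β 0 := zero_le_one.trans (one_le_volumeSusceptibility hβ (zero_mem_box d m))
  set i₀ : Fin d := ⟨0, hd⟩
  set e₀ : Site d := Pi.single i₀ 1 with he₀
  have he₀norm : Site.supNorm e₀ ≤ 1 := by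
    rw [Site.supNorm_le_iff]
    intro i
    by_cases hi : i = i₀
    · subst hi; simp [he₀]
    · simp [he₀, Pi.single_eq_of_ne hi]
  have hadj : ∀ u : Site d, (zdGraph d).Adj u (u + e₀) := fun u =>
    (zdGraph_adj_iff u (u + e₀)).2 ⟨i₀, Or.inl rfl⟩
  -- for `u ∈ Λ_m`: `u + e₀ ∈ Λ_n` and `‖u + e₀‖ + m ≤ n`
  have hnb : ∀ u ∈ box d m, u + e₀ ∈ box d n ∧ Site.supNorm (u + e₀) + m ≤ n := by
    intro u hu
    rw [mem_box_iff_supNorm_le] at hu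
    have h1 := Site.supNorm_add_le u e₀
    exact ⟨mem_box_iff_supNorm_le.2 (by omega), by omega⟩
  unfold drivingTerm
  calc volumeSusceptibility (zdGraph d) (box d m) β 0 ^ 2 = ∑ u ∈ box d m, isingTwoPoint (zdGraph d) (box d m) β 0 .free 0 u * volumeSusceptibility (zdGraph d) (box d m) β 0 := by
        rw [sq, ← Finset.sum_mul]; rfl
    _ ≤ ∑ u ∈ box d m, isingTwoPoint (zdGraph d) (box d n) β 0 .free 0 u *
          volumeSusceptibility (zdGraph d) (box d n) β (u + e₀) :=
        Finset.sum_le_sum fun u hu => mul_le_mul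
          (SpreadOutIsing.isingTwoPoint_free_le_of_subset _ hβ (zero_mem_box d m) hu (box_mono d hmn'))
          (boxSusc_le_volumeSusceptibility hβ (hnb u hu).2) hS0
          (SpreadOutIsing.isingTwoPoint_free_nonneg _ hβ (zero_mem_box d n) (box_mono d hmn' hu))
    _ ≤ ∑ u ∈ box d m, ∑ v ∈ box d n with (zdGraph d).Adj u v,
          isingTwoPoint (zdGraph d) (box d n) β 0 .free 0 u * volumeSusceptibility (zdGraph d) (box d n) β v := by
        refine Finset.sum_le_sum fun u hu => ?_
        have hmem : u + e₀ ∈ (box d n).filter ((zdGraph d).Adj u) := Finset.mem_filter.2 ⟨(hnb u hu).1, hadj u⟩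
        refine Finset.single_le_sum (f := fun v => isingTwoPoint (zdGraph d) (box d n) β 0 .free 0 u *
          volumeSusceptibility (zdGraph d) (box d n) β v) (fun v hv => ?_) hmem
        exact mul_nonneg (SpreadOutIsing.isingTwoPoint_free_nonneg _ hβ (zero_mem_box d n) (box_mono d hmn' hu))
          (Finset.sum_nonneg fun y hy => SpreadOutIsing.isingTwoPoint_free_nonneg _ hβ (Finset.mem_filter.1 hv).1 hy)
    _ ≤ ∑ u ∈ box d n, ∑ v ∈ box d n with (zdGraph d).Adj u v,
          isingTwoPoint (zdGraph d) (box d n) β 0 .free 0 u * volumeSusceptibility (zdGraph d) (box d n) β v := by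
        refine Finset.sum_le_sum_of_subset_of_nonneg (box_mono d hmn') fun u hu _ => ?_
        exact Finset.sum_nonneg fun v hv => mul_nonneg (SpreadOutIsing.isingTwoPoint_free_nonneg _ hβ (zero_mem_box d n) hu)
          (Finset.sum_nonneg fun y hy => SpreadOutIsing.isingTwoPoint_free_nonneg _ hβ (Finset.mem_filter.1 hv).1 hy)

/-- **The increment inequality for the infinite-volume susceptibility** of the nearest-neighbour
model: for `d ≥ 2`, the bubble condition, the Aizenman–Graham inequality in every box, and
`0 ≤ β₁ ≤ β₂ < β_c`, `(β₂ - β₁)(χ_{β₁}² - B₂ χ_{β₂}) ≤ (1 + B₂)(χ_{β₂} - χ_{β₁})`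
(the finite-volume integrated inequality, `M_{Λ_n} ≥ (S_0^{Λ_m})²` for `n ≥ 2m + 1`, and the
limits `S_0^{Λ_n}(β) → χ_β < ∞` below `β_c`). [cite: TasakiHara2015, Ch. 10, Thm. 10.13 (integration of (10.69))] -/
theorem susceptibility_increment_ge (hd : 2 ≤ d) (hB : BubbleCondition d)
    (hAG : ∀ (n : ℕ) (β : ℝ), aizenmanGraham_inequality (zdGraph d) (box d n) β)
    {β₁ β₂ : ℝ} (h0 : 0 ≤ β₁) (h12 : β₁ ≤ β₂) (h2c : β₂ < criticalBeta d) :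
    (β₂ - β₁) * ((susceptibility d β₁).toReal ^ 2 - ((2 * d : ℝ) * (bubbleDiagram d (criticalBeta d)).toReal) * (susceptibility d β₂).toReal) ≤
      (1 + ((2 * d : ℝ) * (bubbleDiagram d (criticalBeta d)).toReal)) * ((susceptibility d β₂).toReal - (susceptibility d β₁).toReal) := by
  have h02 : 0 ≤ β₂ := h0.trans h12
  have hfin1 : susceptibility d β₁ < ∞ := susceptibility_lt_top_of_lt_criticalBeta hd h0 (h12.trans_lt h2c)
  have hfin2 : susceptibility d β₂ < ∞ := susceptibility_lt_top_of_lt_criticalBeta hd h02 h2c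
  set B₂ := ((2 * d : ℝ) * (bubbleDiagram d (criticalBeta d)).toReal) with hB₂
  set χ₁ := (susceptibility d β₁).toReal with hχ₁
  set χ₂ := (susceptibility d β₂).toReal with hχ₂
  have hT1 := tendsto_boxSusc (d := d) h0 hfin1
  have hT2 := tendsto_boxSusc (d := d) h02 hfin2
  -- Step 1: for fixed `m`, let `n → ∞`
  have step1 : ∀ m : ℕ, (β₂ - β₁) * (volumeSusceptibility (zdGraph d) (box d m) β₁ 0 ^ 2 - B₂ * χ₂) ≤ (1 + B₂) * (χ₂ - χ₁) := by
    intro m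
    have hev : ∀ᶠ n : ℕ in atTop, (β₂ - β₁) * (volumeSusceptibility (zdGraph d) (box d m) β₁ 0 ^ 2 - B₂ * volumeSusceptibility (zdGraph d) (box d n) β₂ 0) ≤
        (1 + B₂) * (volumeSusceptibility (zdGraph d) (box d n) β₂ 0 - volumeSusceptibility (zdGraph d) (box d n) β₁ 0) := by
      filter_upwards [eventually_ge_atTop (2 * m + 1)] with n hn
      have h1 := boxSusc_increment_ge hAG hB h0 h12 h2c.le n
      have h2 := sq_le_drivingTerm (d := d) (by omega) h0 hn
      have h3 : (β₂ - β₁) * (volumeSusceptibility (zdGraph d) (box d m) β₁ 0 ^ 2 - B₂ * volumeSusceptibility (zdGraph d) (box d n) β₂ 0) ≤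
          (β₂ - β₁) * (drivingTerm (zdGraph d) (box d n) β₁ 0 - B₂ * volumeSusceptibility (zdGraph d) (box d n) β₂ 0) :=
        mul_le_mul_of_nonneg_left (by linarith) (sub_nonneg.2 h12)
      exact h3.trans h1
    have hlim1 : Tendsto (fun n : ℕ => (β₂ - β₁) * (volumeSusceptibility (zdGraph d) (box d m) β₁ 0 ^ 2 - B₂ * volumeSusceptibility (zdGraph d) (box d n) β₂ 0)) atTop
        (𝓝 ((β₂ - β₁) * (volumeSusceptibility (zdGraph d) (box d m) β₁ 0 ^ 2 - B₂ * χ₂))) :=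
      tendsto_const_nhds.mul (tendsto_const_nhds.sub (tendsto_const_nhds.mul hT2))
    have hlim2 : Tendsto (fun n : ℕ => (1 + B₂) * (volumeSusceptibility (zdGraph d) (box d n) β₂ 0 - volumeSusceptibility (zdGraph d) (box d n) β₁ 0)) atTop
        (𝓝 ((1 + B₂) * (χ₂ - χ₁))) :=
      tendsto_const_nhds.mul (hT2.sub hT1)
    exact le_of_tendsto_of_tendsto hlim1 hlim2 hev
  -- Step 2: let `m → ∞`
  have hlim1 : Tendsto (fun m : ℕ => (β₂ - β₁) * (volumeSusceptibility (zdGraph d) (box d m) β₁ 0 ^ 2 - B₂ * χ₂)) atTop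
      (𝓝 ((β₂ - β₁) * (χ₁ ^ 2 - B₂ * χ₂))) :=
    tendsto_const_nhds.mul ((hT1.pow 2).sub tendsto_const_nhds)
  exact le_of_tendsto hlim1 (Filter.Eventually.of_forall step1)

/-! ### Assembly -/

/-- `χ(β) ≥ 1` as a real number when finite (`β ≥ 0`). [folklore] -/
theorem one_le_susceptibility_toReal {β : ℝ} (hβ : 0 ≤ β) (hfin : susceptibility d β < ∞) :
    1 ≤ (susceptibility d β).toReal := by
  have h := (ofReal_volumeSusceptibility_le_susceptibility (d := d) hβ (zero_mem_box d 0))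
  have h1 : ENNReal.ofReal 1 ≤ susceptibility d β :=
    (ENNReal.ofReal_le_ofReal (one_le_volumeSusceptibility hβ (zero_mem_box d 0))).trans h
  exact (ENNReal.ofReal_le_iff_le_toReal hfin.ne).1 h1

/-- **Aizenman's bubble bound for the nearest-neighbour model from the Aizenman–Graham
inequality** (Tasaki–Hara 2015, Thm. 10.13, upper bound of (10.60), along (10.63)–(10.69);
Aizenman 1982, Aizenman–Graham 1983 as quoted by Sakai 2007, §1.1): granted the finite-volume
Aizenman–Graham inequality in the boxes of `ℤ^d`, for `d ≥ 2` and `B(β_c) < ∞` there are `C` and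
`β₀ < β_c` with `χ(β) ≤ C (β_c - β)⁻¹` on `(β₀, β_c)`; here `C = 2(1 + 2d B(β_c))` and `β₀` is any
point with `χ(β₀) ≥ 4d B(β_c)` (which exists as `χ ↑ ∞`). The printed argument uses periodic
boundary conditions; here the free-boundary finite-volume inequality is integrated and the volume
limit is taken with the monotone convergence of the finite-volume two-point functions.
[cite: TasakiHara2015, Ch. 10, Thm. 10.13 and eqs. (10.63)–(10.69)]
[cite: Sakai2007, §1.1 (bubble condition ⇒ γ = 1)] [cite: AizenmanGraham1983, as cited by Tasaki–Hara 2015 ([52])] -/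
theorem bubble_susceptibility_upper_of_aizenmanGraham
    (hAG : ∀ (d n : ℕ) (β : ℝ), aizenmanGraham_inequality (zdGraph d) (box d n) β) :
    bubble_susceptibility_upper := by
  intro d hd hBC
  set B₂ := ((2 * d : ℝ) * (bubbleDiagram d (criticalBeta d)).toReal) with hB₂
  set A : ℝ := 1 + B₂ with hA
  have hB0 : 0 ≤ B₂ := nnBubbleBoundConst_nonneg d
  have hA0 : 0 < A := by linarith
  -- `β₀ ∈ [0, β_c)` with `χ(β₀) ≥ 2 B₂`
  obtain ⟨β₀, hβ₀0, hβ₀c, hM⟩ := susceptibility_unbounded_below_criticalBeta hd (2 * B₂)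
  have hfin0 : susceptibility d β₀ < ∞ := susceptibility_lt_top_of_lt_criticalBeta hd hβ₀0 hβ₀c
  have hbig : 2 * B₂ ≤ 1 * (susceptibility d β₀).toReal := by
    rw [one_mul]
    exact ((ENNReal.ofReal_le_iff_le_toReal hfin0.ne).1 hM.le)
  set χ : ℝ → ℝ := fun β => (susceptibility d β).toReal with hχ
  refine ⟨2 * A / 1, β₀, hβ₀c, fun β hβl hβc => ?_⟩
  have hβ0 : 0 ≤ β := hβ₀0.trans hβl.le
  have hfin : susceptibility d β < ∞ := susceptibility_lt_top_of_lt_criticalBeta hd hβ0 hβc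
  have key : χ β ≤ 2 * A / 1 * (criticalBeta d - β)⁻¹ := by
    refine le_inv_of_increment_ge (χ := χ) (β₀ := β₀) (βc := criticalBeta d) hA0 one_pos hB0
      ?_ ?_ hbig ?_ hβl.le hβc
    · intro t ht htc
      exact one_le_susceptibility_toReal (hβ₀0.trans ht) (susceptibility_lt_top_of_lt_criticalBeta hd (hβ₀0.trans ht) htc)
    · intro s t hs hst htc
      have hs0 : 0 ≤ s := hβ₀0.trans hs
      exact ENNReal.toReal_mono (susceptibility_lt_top_of_lt_criticalBeta hd (hs0.trans hst) htc).ne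
        (susceptibility_mono hs0 hst)
    · intro s t hs hst htc
      have h := susceptibility_increment_ge hd hBC (hAG d) (hβ₀0.trans hs) hst htc
      simpa only [one_mul] using h
  rw [← ENNReal.ofReal_toReal hfin.ne]
  exact ENNReal.ofReal_le_ofReal key

/-! ### Discharge of `NNIsing.bubble_susceptibility_upper` -/

/-- **Discharge of the named fact `NNIsing.bubble_susceptibility_upper`** (bubble condition ⇒
`γ ≤ 1` for the nearest-neighbour Ising model on `ℤ^d`, `d ≥ 2`: if `B(β_c) < ∞` then
`χ(β) ≤ C (β_c - β)⁻¹` on some `(β₀, β_c)`; Aizenman 1982, Aizenman–Graham 1983 as quoted by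
Sakai 2007, §1.1; Tasaki–Hara 2015, Thm. 10.13): the reduction
`bubble_susceptibility_upper_of_aizenmanGraham` of this file fed with the random-current proof
`aizenmanGraham_inequality_holds` of the finite-volume Aizenman–Graham inequality
(`AizenmanGrahamInequalityProofs.lean`; Tasaki–Hara 2015, Thm. A.18). [cite: Sakai2007, §1.1 (bubble condition ⇒ γ = 1)]
[cite: TasakiHara2015, Ch. 10, Thm. 10.13 with App. A, Thm. A.18] -/
theorem bubble_susceptibility_upper_holds : bubble_susceptibility_upper :=
  bubble_susceptibility_upper_of_aizenmanGraham fun d n β =>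
    aizenmanGraham_inequality_holds (zdGraph d) (box d n) β

end Literature.Barriers.CriticalPhenomena.NNIsing

end
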